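import Literature.NumberTheory.LFunctions.ZetaZeroHarmonicSumUnconditional
import HarnessLib

/-!
# RH-FREE — Brent–Platt–Trudgian 2021 (Math. Comp. 90), Theorems 1–3 PROVED: the `T₂ → ∞` limits of the refined Lehman lemma — existence of `F(T₀) = lim_T (Σ_{T₀<γ≤T} φ(γ) − (1/2π)∫_{T₀}^T φ log(t/2π))`, the identity `F(T₀) = Σ_{T₀<γ≤T₁} − (1/2π)∫_{T₀}^{T₁} − φ(T₁)Q(T₁) + E₂(T₁)`, and `|E₂(T₁)| ≤ 2(A₀ + A₁ log T₁)|φ'(T₁)| + (A₁ + A₂)φ(T₁)/T₁` («nothing here bears on the truth of RH»)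

Topic `Literature/NumberTheory/LFunctions` (RH literature-typing tranche 1, L4 "explicit zero
statistics", gen 7). Label: **RH-FREE** — unconditional statements about the ordinates `γ` of the
non-trivial zeros of `ζ` (nothing about their real parts). THEOREMS only (no definition, no named
fact); standard axioms. Nothing here bears on the truth of RH.

Source: R. P. Brent, D. J. Platt, T. S. Trudgian, *Accurate estimation of sums over zeros of the
Riemann zeta-function*, Math. Comp. 90 (2021) 2923–2935 = arXiv:2009.13791, §1 (Theorem 1),
§4 (Lemma 4, proof of Theorem 1), §5 (Lemmas 5–6, Theorems 2–3)
`[corpus:paper:arxiv-2009.13791 p0003, p0006, p0007]`. Its finite "key result" Lemma 3 is the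
tree's `BrentPlattTrudgian2021_lemma3_E2(_base)` (`ZetaZeroSumsLehmanRefined.lean`, gen 3, whose
docstring left Theorems 1–3 — "the limits of the finite statement" — untyped); the identity (3.1)
is the tree's `lehman_identity` (`ZetaZeroSumsLehmanExplicit.lean`).

Vocabulary (all from the tree): `N(T) = zetaZeroCount T`, Backlund's main term
`L(T) = countMain T = (T/2π) log(T/2π) − T/2π + 7/8`, `Q = N − L`, `S = zetaArgS`, the zeros with
`T₁ < γ ≤ T₂` = `zerosBetween T₁ T₂` with multiplicities `m(ρ) = riemannZetaZeroOrder ρ`. The source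
averages `N` at the ordinates and gives the end-points of `Σ'` weight `½`; the tree's `N` is
right-continuous and its sums are over `T₁ < γ ≤ T₂` — (3.1) holds verbatim in this convention and
every limit statement below is insensitive to it.

## What is proved (for `φ ∈ C¹[T₀,∞)`, `φ ≥ 0`, `φ' ≤ 0`, and the "mild condition" (5.1) `∫_{T₀}^∞ φ(t)/t dt < ∞`)

* `BPT2021.tendsto_mul_log` — **Lemma 5**: `φ(t) log t → 0` (direct proof:
  `φ(t) log t = 2φ(t)∫_{√t}^t du/u ≤ 2∫_{√t}^∞ φ(u)/u du → 0`); `BPT2021.tendsto_zero`.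
* `BPT2021.integral_log_mul_neg_deriv_le`, `BPT2021.integrableOn_log_mul_neg_deriv` — **Lemma 6** in
  the quantitative form `∫_{T₀}^T (A log t + B)(−φ') ≤ (A log T₀ + B)φ(T₀) + A∫_{T₀}^∞ φ/t` (by
  parts); hence (`BPT2021.integrableOn_count_sub_countMain_mul_deriv`) `Q φ'` is integrable on
  `(T₀, ∞)` and (`BPT2021.tendsto_mul_count_sub_countMain`) `φ(T)Q(T) → 0`, using the tree's PROVED
  Hasanalizade–Shen–Wong bound `|Q(t)| ≤ 0.1038 log t + 0.2573 log log t + 10.2425`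
  (`abs_count_sub_countMain_le_hsw`, `t ≥ e`, standard axioms; packaged as
  `BPT2021.abs_count_sub_countMain_le`: `≤ 0.3611 log t + 10.2425` for `t ≥ 3`) — so NO named fact
  enters, and the theorems ask `T₀ ≥ 3` (source: `T₀ ≥ 2π`).
* `BrentPlattTrudgian2021_thm2` — **Theorem 2**: the limit
  `F(T₀) = lim_T (Σ_{T₀<γ≤T} m φ(γ) − (1/2π)∫_{T₀}^T φ log(t/2π))` exists and equals
  `−φ(T₀)Q(T₀) − ∫_{T₀}^∞ φ'Q` (eq. (5.2)); `φ'' ≥ 0` is not needed for this statement.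
* `BrentPlattTrudgian2021_thm3_eq` — **Theorem 3**, the identity
  `F(T₀) = Σ_{T₀<γ≤T₁} m φ − (1/2π)∫_{T₀}^{T₁} φ log(t/2π) − φ(T₁)Q(T₁) + E₂(T₁)`, `E₂(T₁) = −∫_{T₁}^∞ φ'Q`.
* `BPT2021.abs_integral_Ioi_count_sub_countMain_mul_deriv_le` — the Lehman-type bound
  `|E₂(T₁)| ≤ (A log T₁ + B)φ(T₁) + A∫_{T₁}^∞ φ/t` from `|Q| ≤ A log t + B` on `[T₁,∞)` (Lemma 1 =
  Lehman's lemma with `T₂ = ∞`).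
* `BrentPlattTrudgian2021_thm1_E2_base`, `BrentPlattTrudgian2021_thm1_E2` — **the bound (1.3) of
  Theorems 1 and 3**: for `φ'' ≥ 0`, `|∫_a^t S| ≤ A₀ + A₁ log t` and `|Q − S| ≤ A₂/t` on `[T₁,∞)`,
  `|E₂(T₁)| ≤ 2(A₀ + A₁ log T₁)|φ'(T₁)| + (A₁ + A₂)φ(T₁)/T₁` (with the base point `a = T₁` the factor
  `2` drops), by `T₂ → ∞` in the finite Lemma 3.
* `BrentPlattTrudgian2021_thm1` — **Theorem 1** (convergent sums): if `∫_{T₁}^∞ φ log(t/2π) < ∞`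
  then `Σ_{T₁<γ≤T₂} m φ(γ) → (1/2π)∫_{T₁}^∞ φ log(t/2π) − φ(T₁)Q(T₁) + E₂(T₁)` as `T₂ → ∞`
  (eqs. (1.1)–(1.2); `BPT2021.integrableOn_div_of_integrableOn_mul_log` is the first sentence of §4:
  `∫φ log < ∞ ⇒ ∫φ/t < ∞`).
* Calculus for the source's running example `φ(t) = 1/t` (§1: "if `φ(t) = 1/t` and `T₀ = 2π` … the
  constant `H = F(2π)`"), used by the companion file `ZetaZeroHarmonicLimit.lean` (the constant `H`
  of the Bull. Aust. Math. Soc. paper): `BPT2021.hasDerivAt_one_div`, `hasDerivAt_neg_one_div_sq`,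
  `continuousOn_two_div_cube`, `continuousOn_neg_one_div_sq`, `integrableOn_one_div_div`,
  `integral_Ioi_one_div_div` (`∫_T^∞ dt/t² = 1/T`).

Deliberately NOT here: the constants `H`, `c₁`, `c₂` (Examples 1–2, Corollaries 1–2) — `H` is the
companion file; `c₁` is the named fact `BrentPlattTrudgian2021_cor1`.

## References

* R. P. Brent, D. J. Platt, T. S. Trudgian, Math. Comp. 90 (2021) 2923–2935, §1 Thm 1 (1.1)–(1.3),
  §4 Lemma 4, §5 Lemmas 5–6, Thms 2–3 (5.1)–(5.2). [BrentPlattTrudgian2021]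
* R. P. Brent, D. J. Platt, T. S. Trudgian, J. Number Theory 238 (2022) 740–762, Lemma 2 (Lehman's
  lemma). [BrentPlattTrudgian2022]
* R. S. Lehman, Acta Arith. 11 (1966) 397–410, Lemma. [Lehman1966]
* E. Hasanalizade, Q. Shen, P.-J. Wong, J. Number Theory 235 (2022), Cor. 1.2 (the `Q ≪ log T`
  input, a tree theorem). [HasanalizadeShenWong2022]
-/


noncomputable section

open Filter Set MeasureTheory intervalIntegral
open scoped Real Topology

namespace Literature.NumberTheory.LFunctions

open SchoenfeldBound

/-! ## Analytic preliminaries on the test function (Brent–Platt–Trudgian 2021, Lemmas 4–6)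

Standing data: `T₀ ≥ 1`, `φ ∈ C¹[T₀, ∞)` with `φ ≥ 0`, `φ' ≤ 0`, and `∫_{T₀}^∞ φ(t)/t dt < ∞`
(the source's condition (5.1)). -/

/-- `φ' ≤ 0` on `[T₀, ∞)` makes `φ` non-increasing there (the source's standing assumption "`φ'(t) ≤ 0`
… on `[T₀,∞)`"). [cite: BrentPlattTrudgian2021, §1 (conditions on φ)] -/
theorem BPT2021.antitoneOn_of_deriv_nonpos {T₀ : ℝ} {φ φ' : ℝ → ℝ}
    (hφ : ∀ t ∈ Ici T₀, HasDerivAt φ (φ' t) t) (hφ'0 : ∀ t ∈ Ici T₀, φ' t ≤ 0) :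
    AntitoneOn φ (Ici T₀) := by
  have hc : ContinuousOn φ (Ici T₀) := fun t ht ↦ (hφ t ht).continuousAt.continuousWithinAt
  refine antitoneOn_of_hasDerivWithinAt_nonpos (convex_Ici T₀) hc (f' := φ') ?_ ?_
  · intro t ht
    exact (hφ t (interior_subset ht)).hasDerivWithinAt
  · intro t ht
    exact hφ'0 t (interior_subset ht)

/-- **Brent–Platt–Trudgian 2021, Lemma 5** (in the form used): if `φ ≥ 0` is non-increasing on
`[T₀, ∞)` and `∫_{T₀}^∞ φ(t)/t dt < ∞`, then `φ(t) log t → 0`. (Direct proof: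
`φ(t) log t / 2 = φ(t) ∫_{√t}^t du/u ≤ ∫_{√t}^∞ φ(u)/u du → 0`.)
[cite: BrentPlattTrudgian2021, Lemma 5] -/
theorem BPT2021.tendsto_mul_log {T₀ : ℝ} (h0 : 1 ≤ T₀) {φ φ' : ℝ → ℝ}
    (hφ : ∀ t ∈ Ici T₀, HasDerivAt φ (φ' t) t) (hφ0 : ∀ t ∈ Ici T₀, 0 ≤ φ t)
    (hφ'0 : ∀ t ∈ Ici T₀, φ' t ≤ 0) (hint : IntegrableOn (fun t ↦ φ t / t) (Ioi T₀)) :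
    Tendsto (fun t ↦ φ t * Real.log t) atTop (𝓝 0) := by
  have hanti := BPT2021.antitoneOn_of_deriv_nonpos hφ hφ'0
  have hcont : ContinuousOn φ (Ici T₀) := fun t ht ↦ (hφ t ht).continuousAt.continuousWithinAt
  -- the tail integrals `∫_{√t}^∞ φ/u` tend to `0`
  have htail : Tendsto (fun t ↦ ∫ u in Ioi (Real.sqrt t), φ u / u) atTop (𝓝 0) :=
    tendsto_integral_Ioi_zero Real.tendsto_sqrt_atTop
  have htail2 : Tendsto (fun t ↦ 2 * ∫ u in Ioi (Real.sqrt t), φ u / u) atTop (𝓝 0) := by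
    simpa using htail.const_mul 2
  refine squeeze_zero' ?_ ?_ htail2
  · filter_upwards [eventually_ge_atTop T₀] with t ht
    exact mul_nonneg (hφ0 t ht) (Real.log_nonneg (h0.trans ht))
  · filter_upwards [eventually_ge_atTop (T₀ ^ 2), eventually_ge_atTop (1 : ℝ)] with t ht ht1
    have hT0 : 0 ≤ T₀ := by linarith
    have ht0 : 0 < t := by linarith
    have hst : T₀ ≤ Real.sqrt t := by
      rw [show T₀ = Real.sqrt (T₀ ^ 2) by rw [Real.sqrt_sq hT0]]
      exact Real.sqrt_le_sqrt ht
    have hs0 : 0 < Real.sqrt t := by linarith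
    have hst' : Real.sqrt t ≤ t := by
      rw [Real.sqrt_le_left (by linarith)]
      nlinarith
    -- split the tail at `t`
    have hint' : IntegrableOn (fun u ↦ φ u / u) (Ioi (Real.sqrt t)) :=
      hint.mono_set (Ioi_subset_Ioi hst)
    have hsplit : ∫ u in Ioi (Real.sqrt t), φ u / u =
        (∫ u in Real.sqrt t..t, φ u / u) + ∫ u in Ioi t, φ u / u := by
      rw [← intervalIntegral.integral_Ioi_sub_Ioi hint' hst']
      ring
    have htail_nonneg : 0 ≤ ∫ u in Ioi t, φ u / u := by
      refine setIntegral_nonneg measurableSet_Ioi fun u hu ↦ ?_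
      have hu : t < u := hu
      exact div_nonneg (hφ0 u (by simp only [mem_Ici]; linarith)) (by linarith)
    -- on `[√t, t]`, `φ(u)/u ≥ φ(t)/u`
    have hIcc : uIcc (Real.sqrt t) t = Icc (Real.sqrt t) t := uIcc_of_le hst'
    have hφc : ContinuousOn (fun u ↦ φ u / u) (Icc (Real.sqrt t) t) := by
      refine (hcont.mono fun u hu ↦ ?_).div continuousOn_id fun u hu ↦ ?_
      · exact hst.trans hu.1
      · exact (hs0.trans_le hu.1).ne'
    have hci : IntervalIntegrable (fun u ↦ φ u / u) volume (Real.sqrt t) t :=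
      hφc.intervalIntegrable_of_Icc hst'
    have hki : IntervalIntegrable (fun u ↦ φ t / u) volume (Real.sqrt t) t := by
      refine (continuousOn_const.div continuousOn_id fun u hu ↦ ?_).intervalIntegrable_of_Icc hst'
      exact (hs0.trans_le hu.1).ne'
    have hmono : ∫ u in Real.sqrt t..t, φ t / u ≤ ∫ u in Real.sqrt t..t, φ u / u := by
      refine intervalIntegral.integral_mono_on hst' hki hci fun u hu ↦ ?_
      have hu0 : 0 < u := hs0.trans_le hu.1
      have hu_mem : u ∈ Ici T₀ := hst.trans hu.1
      have ht_mem : t ∈ Ici T₀ := hst.trans hst'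
      exact div_le_div_of_nonneg_right (hanti hu_mem ht_mem hu.2) hu0.le
    have hval : ∫ u in Real.sqrt t..t, φ t / u = φ t * Real.log t / 2 := by
      have e : (fun u ↦ φ t / u) = fun u ↦ φ t * u⁻¹ := by
        funext u; rw [div_eq_mul_inv]
      rw [e, intervalIntegral.integral_const_mul, integral_inv_of_pos hs0 ht0,
        Real.log_div ht0.ne' hs0.ne', Real.log_sqrt ht0.le]
      ring
    rw [hsplit]
    linarith

/-- Under the same hypotheses `φ(t) → 0`. [cite: BrentPlattTrudgian2021, Lemma 5] -/
theorem BPT2021.tendsto_zero {T₀ : ℝ} (h0 : 1 ≤ T₀) {φ φ' : ℝ → ℝ}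
    (hφ : ∀ t ∈ Ici T₀, HasDerivAt φ (φ' t) t) (hφ0 : ∀ t ∈ Ici T₀, 0 ≤ φ t)
    (hφ'0 : ∀ t ∈ Ici T₀, φ' t ≤ 0) (hint : IntegrableOn (fun t ↦ φ t / t) (Ioi T₀)) :
    Tendsto φ atTop (𝓝 0) := by
  have h := BPT2021.tendsto_mul_log h0 hφ hφ0 hφ'0 hint
  refine squeeze_zero' ?_ ?_ h
  · filter_upwards [eventually_ge_atTop T₀] with t ht using hφ0 t ht
  · filter_upwards [eventually_ge_atTop T₀, eventually_ge_atTop (Real.exp 1)] with t ht hte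
    have hlog : 1 ≤ Real.log t := by
      rw [← Real.log_exp 1]
      exact Real.log_le_log (Real.exp_pos 1) hte
    have := hφ0 t ht
    nlinarith

/-- **Brent–Platt–Trudgian 2021, Lemma 6** (quantitative form): for `A, B ≥ 0`, `T₀ ≥ 1` and `φ`
as above, `t ↦ (A log t + B)(−φ'(t))` is integrable on `(T₀, ∞)`, with
`∫_{T₀}^{T} (A log t + B)(−φ') ≤ (A log T₀ + B)φ(T₀) + A∫_{T₀}^∞ φ/t` for every `T ≥ T₀`
(integration by parts). [cite: BrentPlattTrudgian2021, Lemma 6] -/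
theorem BPT2021.integral_log_mul_neg_deriv_le {T₀ A B : ℝ} (h0 : 1 ≤ T₀) (hA : 0 ≤ A) (hB : 0 ≤ B)
    {φ φ' : ℝ → ℝ} (hφ : ∀ t ∈ Ici T₀, HasDerivAt φ (φ' t) t) (hφ'c : ContinuousOn φ' (Ici T₀))
    (hφ0 : ∀ t ∈ Ici T₀, 0 ≤ φ t)
    (hint : IntegrableOn (fun t ↦ φ t / t) (Ioi T₀)) {T : ℝ} (hT : T₀ ≤ T) :
    ∫ t in T₀..T, (A * Real.log t + B) * (-φ' t) ≤
      (A * Real.log T₀ + B) * φ T₀ + A * ∫ t in Ioi T₀, φ t / t := by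
  have hT0 : 0 < T₀ := by linarith
  have hIcc : uIcc T₀ T = Icc T₀ T := uIcc_of_le hT
  have hud : ∀ t ∈ uIcc T₀ T, HasDerivAt (fun s ↦ A * Real.log s + B) (A / t) t := by
    intro t ht
    rw [hIcc] at ht
    have ht0 : t ≠ 0 := by linarith [ht.1]
    have h := ((Real.hasDerivAt_log ht0).const_mul A).add_const B
    simpa [div_eq_mul_inv] using h
  have hφd : ∀ t ∈ uIcc T₀ T, HasDerivAt φ (φ' t) t := by
    intro t ht; rw [hIcc] at ht; exact hφ t ht.1
  have hu'i : IntervalIntegrable (fun t ↦ A / t) volume T₀ T := by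
    refine (continuousOn_const.div continuousOn_id fun t ht ↦ ?_).intervalIntegrable_of_Icc hT
    exact (by linarith [ht.1] : (t : ℝ) ≠ 0)
  have hφ'i : IntervalIntegrable φ' volume T₀ T :=
    (hφ'c.mono Icc_subset_Ici_self).intervalIntegrable_of_Icc hT
  have hparts := integral_mul_deriv_eq_deriv_mul hud hφd hu'i hφ'i
  -- ∫ (A log t + B)(-φ') = -(∫ (A log t + B) φ')
  have e1 : ∫ t in T₀..T, (A * Real.log t + B) * (-φ' t) =
      -∫ t in T₀..T, (A * Real.log t + B) * φ' t := by
    rw [← intervalIntegral.integral_neg]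
    exact intervalIntegral.integral_congr fun t _ ↦ by ring
  have e2 : ∫ t in T₀..T, A / t * φ t = A * ∫ t in T₀..T, φ t / t := by
    rw [← intervalIntegral.integral_const_mul]
    exact intervalIntegral.integral_congr fun t _ ↦ by ring
  rw [e1, hparts, e2]
  -- the boundary term at `T` is ≥ 0, the finite integral is ≤ the improper one
  have hlogT : 0 ≤ Real.log T := Real.log_nonneg (h0.trans hT)
  have hbT : 0 ≤ (A * Real.log T + B) * φ T := by
    have := hφ0 T hT
    positivity
  have hfin : ∫ t in T₀..T, φ t / t ≤ ∫ t in Ioi T₀, φ t / t := by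
    rw [← intervalIntegral.integral_Ioi_sub_Ioi hint hT]
    have : 0 ≤ ∫ t in Ioi T, φ t / t := by
      refine setIntegral_nonneg measurableSet_Ioi fun u hu ↦ ?_
      have hu : T < u := hu
      exact div_nonneg (hφ0 u (show u ∈ Ici T₀ by simp only [mem_Ici]; linarith)) (by linarith)
    linarith
  nlinarith

/-- Integrability of the majorant: `t ↦ (A log t + B)(−φ'(t))` is integrable on `(T₀, ∞)`.
[cite: BrentPlattTrudgian2021, Lemma 6] -/
theorem BPT2021.integrableOn_log_mul_neg_deriv {T₀ A B : ℝ} (h0 : 1 ≤ T₀) (hA : 0 ≤ A) (hB : 0 ≤ B)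
    {φ φ' : ℝ → ℝ} (hφ : ∀ t ∈ Ici T₀, HasDerivAt φ (φ' t) t) (hφ'c : ContinuousOn φ' (Ici T₀))
    (hφ0 : ∀ t ∈ Ici T₀, 0 ≤ φ t) (hφ'0 : ∀ t ∈ Ici T₀, φ' t ≤ 0)
    (hint : IntegrableOn (fun t ↦ φ t / t) (Ioi T₀)) :
    IntegrableOn (fun t ↦ (A * Real.log t + B) * (-φ' t)) (Ioi T₀) := by
  have hlogc : ContinuousOn (fun t : ℝ ↦ A * Real.log t + B) (Ici T₀) := by
    refine (continuousOn_const.mul (Real.continuousOn_log.mono fun t ht ↦ ?_)).add continuousOn_const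
    exact (by simp only [mem_Ici] at ht; simp only [mem_singleton_iff]; linarith : t ∉ ({0} : Set ℝ))
  have hgc : ContinuousOn (fun t ↦ (A * Real.log t + B) * (-φ' t)) (Ici T₀) := hlogc.mul hφ'c.neg
  refine integrableOn_Ioi_of_intervalIntegral_norm_bounded
    ((A * Real.log T₀ + B) * φ T₀ + A * ∫ t in Ioi T₀, φ t / t) T₀ (l := atTop) (b := fun i ↦ i)
    (fun i ↦ ?_) tendsto_id ?_
  · exact ((hgc.mono Icc_subset_Ici_self).integrableOn_Icc (μ := volume) (a := T₀) (b := i)).mono_set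
      Ioc_subset_Icc_self
  · filter_upwards [eventually_ge_atTop T₀] with i hi
    have hnn : ∀ t ∈ Icc T₀ i, 0 ≤ (A * Real.log t + B) * (-φ' t) := by
      intro t ht
      have h1 : 0 ≤ Real.log t := Real.log_nonneg (h0.trans ht.1)
      have h2 := hφ'0 t ht.1
      have : 0 ≤ -φ' t := by linarith
      positivity
    have e : ∫ t in T₀..i, ‖(A * Real.log t + B) * (-φ' t)‖ =
        ∫ t in T₀..i, (A * Real.log t + B) * (-φ' t) := by
      refine intervalIntegral.integral_congr fun t ht ↦ ?_
      rw [uIcc_of_le hi] at ht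
      rw [Real.norm_eq_abs, abs_of_nonneg (hnn t ht)]
    rw [e]
    exact BPT2021.integral_log_mul_neg_deriv_le h0 hA hB hφ hφ'c hφ0 hint hi


/-! ## The remainder `Q = N − L` against the test function: integrability and decay -/

/-- An explicit `Q ≪ log t` with standard axioms only: `|Q(t)| ≤ 0.3611 log t + 10.2425` for
`t ≥ 3`, from the tree's PROVED Hasanalizade–Shen–Wong bound
`|N − L| ≤ 0.1038 log t + 0.2573 log log t + 10.2425` (`abs_count_sub_countMain_le_hsw`, `t ≥ e`)
and `log log t ≤ log t`. (Any `O(log t)` bound would do for the limit theorems below.)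
[cite: BrentPlattTrudgian2021, §2 (Q ≪ log T)] -/
theorem BPT2021.abs_count_sub_countMain_le {t : ℝ} (ht : 3 ≤ t) :
    |(zetaZeroCount t : ℝ) - countMain t| ≤ 0.3611 * Real.log t + 10.2425 := by
  have he : Real.exp 1 ≤ t := by
    have := Real.exp_one_lt_d9
    linarith
  have h := abs_count_sub_countMain_le_hsw he
  unfold FKS2023.countErr at h
  have hlog0 : 0 ≤ Real.log t := Real.log_nonneg (by linarith)
  have hll : Real.log (Real.log t) ≤ Real.log t := Real.log_le_self hlog0
  linarith

/-- `φ(T)Q(T) → 0` as `T → ∞` (`Q ≪ log T` and Lemma 5). [cite: BrentPlattTrudgian2021, Theorem 2 (proof)] -/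
theorem BPT2021.tendsto_mul_count_sub_countMain {T₀ : ℝ} (h0 : 1 ≤ T₀) {φ φ' : ℝ → ℝ}
    (hφ : ∀ t ∈ Ici T₀, HasDerivAt φ (φ' t) t) (hφ0 : ∀ t ∈ Ici T₀, 0 ≤ φ t)
    (hφ'0 : ∀ t ∈ Ici T₀, φ' t ≤ 0) (hint : IntegrableOn (fun t ↦ φ t / t) (Ioi T₀)) :
    Tendsto (fun T ↦ ((zetaZeroCount T : ℝ) - countMain T) * φ T) atTop (𝓝 0) := by
  have h1 := BPT2021.tendsto_mul_log h0 hφ hφ0 hφ'0 hint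
  have h2 := BPT2021.tendsto_zero h0 hφ hφ0 hφ'0 hint
  have hmaj : Tendsto (fun T ↦ 0.3611 * (φ T * Real.log T) + 10.2425 * φ T) atTop (𝓝 0) := by
    simpa using (h1.const_mul 0.3611).add (h2.const_mul 10.2425)
  rw [tendsto_zero_iff_abs_tendsto_zero]
  refine squeeze_zero' (Eventually.of_forall fun T ↦ abs_nonneg _) ?_ hmaj
  filter_upwards [eventually_ge_atTop T₀, eventually_ge_atTop (3 : ℝ)] with T hT hT3
  have hQ := BPT2021.abs_count_sub_countMain_le hT3
  have hφT := hφ0 T hT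
  show |((zetaZeroCount T : ℝ) - countMain T) * φ T| ≤ _
  rw [abs_mul, abs_of_nonneg hφT]
  nlinarith

/-- `Q φ'` is integrable on `(T₀, ∞)` for `T₀ ≥ 3` (dominated by `(0.3611 log t + 10.2425)|φ'|`,
Lemma 6). [cite: BrentPlattTrudgian2021, Theorem 2 (proof)] -/
theorem BPT2021.integrableOn_count_sub_countMain_mul_deriv {T₀ : ℝ} (h0 : 3 ≤ T₀) {φ φ' : ℝ → ℝ}
    (hφ : ∀ t ∈ Ici T₀, HasDerivAt φ (φ' t) t) (hφ'c : ContinuousOn φ' (Ici T₀))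
    (hφ0 : ∀ t ∈ Ici T₀, 0 ≤ φ t) (hφ'0 : ∀ t ∈ Ici T₀, φ' t ≤ 0)
    (hint : IntegrableOn (fun t ↦ φ t / t) (Ioi T₀)) :
    IntegrableOn (fun t ↦ ((zetaZeroCount t : ℝ) - countMain t) * φ' t) (Ioi T₀) := by
  have h1 : (1 : ℝ) ≤ T₀ := by linarith
  have hmaj := BPT2021.integrableOn_log_mul_neg_deriv h1 (by norm_num : (0 : ℝ) ≤ 0.3611)
    (by norm_num : (0 : ℝ) ≤ 10.2425) hφ hφ'c hφ0 hφ'0 hint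
  refine hmaj.mono' ?_ ?_
  · -- measurability on `(T₀, ∞)`: `N` is monotone, `L` and `φ'` are continuous there
    have hN : AEStronglyMeasurable (fun t ↦ (zetaZeroCount t : ℝ)) (volume.restrict (Ioi T₀)) :=
      (SelbergFujii.monotone_zetaZeroCount_real.measurable).aestronglyMeasurable
    have hL : AEStronglyMeasurable countMain (volume.restrict (Ioi T₀)) := by
      refine ContinuousOn.aestronglyMeasurable (fun t ht ↦ ?_) measurableSet_Ioi
      have ht' : T₀ < t := ht
      exact (hasDerivAt_countMain (by linarith)).continuousAt.continuousWithinAt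
    have hφ'm : AEStronglyMeasurable φ' (volume.restrict (Ioi T₀)) :=
      (hφ'c.mono Ioi_subset_Ici_self).aestronglyMeasurable measurableSet_Ioi
    exact (hN.sub hL).mul hφ'm
  · refine (ae_restrict_iff' measurableSet_Ioi).2 (Eventually.of_forall fun t ht ↦ ?_)
    have ht : T₀ < t := ht
    have hQ := BPT2021.abs_count_sub_countMain_le (by linarith : (3 : ℝ) ≤ t)
    have hφ't := hφ'0 t (le_of_lt ht)
    rw [Real.norm_eq_abs, abs_mul, abs_of_nonpos hφ't]
    exact mul_le_mul_of_nonneg_right hQ (by linarith)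

/-! ## Theorem 2: the limit `F(T₀)` of a (possibly divergent) sum minus its integral exists -/

/-- **Brent–Platt–Trudgian 2021, Theorem 2** (in the tree's right-continuous convention, sums over
`T₀ < γ ≤ T` with multiplicity): for `T₀ ≥ 3` and `φ ∈ C¹[T₀,∞)`, `φ ≥ 0`, `φ' ≤ 0`,
`∫_{T₀}^∞ φ(t)/t dt < ∞`, the limit
`F(T₀) = lim_{T→∞} (Σ_{T₀<γ≤T} m(ρ)φ(γ) − (1/2π)∫_{T₀}^T φ(t) log(t/2π) dt)` exists and equals
`−φ(T₀)Q(T₀) − ∫_{T₀}^∞ φ'(t)Q(t) dt` (eq. (5.2)). (The source takes `T₀ ≥ 2π` and `φ'' ≥ 0`;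
neither is needed for this statement.) [cite: BrentPlattTrudgian2021, Theorem 2] -/
theorem BrentPlattTrudgian2021_thm2 {T₀ : ℝ} (h0 : 3 ≤ T₀) {φ φ' : ℝ → ℝ}
    (hφ : ∀ t ∈ Ici T₀, HasDerivAt φ (φ' t) t) (hφ'c : ContinuousOn φ' (Ici T₀))
    (hφ0 : ∀ t ∈ Ici T₀, 0 ≤ φ t) (hφ'0 : ∀ t ∈ Ici T₀, φ' t ≤ 0)
    (hint : IntegrableOn (fun t ↦ φ t / t) (Ioi T₀)) :
    Tendsto (fun T ↦ ∑ ρ ∈ zerosBetween T₀ T, (riemannZetaZeroOrder ρ : ℝ) * φ ρ.im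
        - (∫ t in T₀..T, φ t * Real.log (t / (2 * π))) / (2 * π)) atTop
      (𝓝 (-(φ T₀ * ((zetaZeroCount T₀ : ℝ) - countMain T₀))
        - ∫ t in Ioi T₀, ((zetaZeroCount t : ℝ) - countMain t) * φ' t)) := by
  have hT0 : 0 < T₀ := by linarith
  have h1 : (1 : ℝ) ≤ T₀ := by linarith
  have hQi := BPT2021.integrableOn_count_sub_countMain_mul_deriv h0 hφ hφ'c hφ0 hφ'0 hint
  have hlimI := intervalIntegral_tendsto_integral_Ioi T₀ hQi tendsto_id
  have hlimB := BPT2021.tendsto_mul_count_sub_countMain h1 hφ hφ0 hφ'0 hint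
  have hlim := (hlimB.sub (tendsto_const_nhds (x := φ T₀ * ((zetaZeroCount T₀ : ℝ) - countMain T₀)))).sub hlimI
  simp only [zero_sub, id] at hlim
  refine hlim.congr' ?_
  filter_upwards [eventually_ge_atTop T₀] with T hT
  have hφI : ∀ t ∈ Icc T₀ T, HasDerivAt φ (φ' t) t := fun t ht ↦ hφ t ht.1
  have hφ'I : ContinuousOn φ' (Icc T₀ T) := hφ'c.mono Icc_subset_Ici_self
  rw [lehman_identity hT0 hT hφI hφ'I]
  ring

/-- **Brent–Platt–Trudgian 2021, Theorem 3 (the identity)**: for `3 ≤ T₀ ≤ T₁`,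
`F(T₀) = (Σ_{T₀<γ≤T₁} m(ρ)φ(γ) − (1/2π)∫_{T₀}^{T₁} φ log(t/2π)) − φ(T₁)Q(T₁) + E₂(T₁)` with
`E₂(T₁) = −∫_{T₁}^∞ φ'(t)Q(t) dt`, where `F(T₀) = −φ(T₀)Q(T₀) − ∫_{T₀}^∞ φ'Q` is the limit of
Theorem 2. [cite: BrentPlattTrudgian2021, Theorem 3] -/
theorem BrentPlattTrudgian2021_thm3_eq {T₀ T₁ : ℝ} (h0 : 3 ≤ T₀) (h01 : T₀ ≤ T₁) {φ φ' : ℝ → ℝ}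
    (hφ : ∀ t ∈ Ici T₀, HasDerivAt φ (φ' t) t) (hφ'c : ContinuousOn φ' (Ici T₀))
    (hφ0 : ∀ t ∈ Ici T₀, 0 ≤ φ t) (hφ'0 : ∀ t ∈ Ici T₀, φ' t ≤ 0)
    (hint : IntegrableOn (fun t ↦ φ t / t) (Ioi T₀)) :
    -(φ T₀ * ((zetaZeroCount T₀ : ℝ) - countMain T₀))
        - ∫ t in Ioi T₀, ((zetaZeroCount t : ℝ) - countMain t) * φ' t =
      (∑ ρ ∈ zerosBetween T₀ T₁, (riemannZetaZeroOrder ρ : ℝ) * φ ρ.im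
          - (∫ t in T₀..T₁, φ t * Real.log (t / (2 * π))) / (2 * π))
        - φ T₁ * ((zetaZeroCount T₁ : ℝ) - countMain T₁)
        - ∫ t in Ioi T₁, ((zetaZeroCount t : ℝ) - countMain t) * φ' t := by
  have hT0 : 0 < T₀ := by linarith
  have hQi := BPT2021.integrableOn_count_sub_countMain_mul_deriv h0 hφ hφ'c hφ0 hφ'0 hint
  have hsplit := intervalIntegral.integral_Ioi_sub_Ioi hQi h01
  have hφI : ∀ t ∈ Icc T₀ T₁, HasDerivAt φ (φ' t) t := fun t ht ↦ hφ t ht.1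
  have hφ'I : ContinuousOn φ' (Icc T₀ T₁) := hφ'c.mono Icc_subset_Ici_self
  rw [lehman_identity hT0 h01 hφI hφ'I]
  linarith

/-! ## The error term `E₂(T₁) = −∫_{T₁}^∞ φ'Q`: the Lehman-type bound and the refined bound (3.2) -/

/-- **Lehman-type bound for `E₂`**: if `|Q(t)| ≤ A log t + B` for `t ≥ T₁` (`A, B ≥ 0`,
`T₁ ≥ 3`), then `|∫_{T₁}^∞ φ'Q| ≤ (A log T₁ + B)φ(T₁) + A∫_{T₁}^∞ φ(t)/t dt` — the
`T₂ → ∞` form of Lehman's lemma (Brent–Platt–Trudgian 2021, Lemma 1 / 2022, Lemma 2).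
[cite: BrentPlattTrudgian2021, Lemma 1] -/
theorem BPT2021.abs_integral_Ioi_count_sub_countMain_mul_deriv_le {T₁ A B : ℝ} (h1 : 3 ≤ T₁)
    (hA : 0 ≤ A) (hB : 0 ≤ B)
    (hQ : ∀ t : ℝ, T₁ ≤ t → |(zetaZeroCount t : ℝ) - countMain t| ≤ A * Real.log t + B)
    {φ φ' : ℝ → ℝ} (hφ : ∀ t ∈ Ici T₁, HasDerivAt φ (φ' t) t) (hφ'c : ContinuousOn φ' (Ici T₁))
    (hφ0 : ∀ t ∈ Ici T₁, 0 ≤ φ t) (hφ'0 : ∀ t ∈ Ici T₁, φ' t ≤ 0)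
    (hint : IntegrableOn (fun t ↦ φ t / t) (Ioi T₁)) :
    |∫ t in Ioi T₁, ((zetaZeroCount t : ℝ) - countMain t) * φ' t| ≤
      (A * Real.log T₁ + B) * φ T₁ + A * ∫ t in Ioi T₁, φ t / t := by
  have h1' : (1 : ℝ) ≤ T₁ := by linarith
  have hQi := BPT2021.integrableOn_count_sub_countMain_mul_deriv h1 hφ hφ'c hφ0 hφ'0 hint
  have hgi := BPT2021.integrableOn_log_mul_neg_deriv h1' hA hB hφ hφ'c hφ0 hφ'0 hint
  -- `|∫ Qφ'| ≤ ∫ |Qφ'| ≤ ∫ (A log t + B)(-φ')`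
  have hle : |∫ t in Ioi T₁, ((zetaZeroCount t : ℝ) - countMain t) * φ' t| ≤
      ∫ t in Ioi T₁, (A * Real.log t + B) * (-φ' t) := by
    calc |∫ t in Ioi T₁, ((zetaZeroCount t : ℝ) - countMain t) * φ' t|
        ≤ ∫ t in Ioi T₁, |((zetaZeroCount t : ℝ) - countMain t) * φ' t| := by
          simpa only [Real.norm_eq_abs] using
            norm_integral_le_integral_norm (μ := volume.restrict (Ioi T₁))
              (fun t ↦ ((zetaZeroCount t : ℝ) - countMain t) * φ' t)
      _ ≤ ∫ t in Ioi T₁, (A * Real.log t + B) * (-φ' t) := by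
          refine setIntegral_mono_on hQi.abs hgi measurableSet_Ioi fun t ht ↦ ?_
          have ht : T₁ < t := ht
          have hφ't := hφ'0 t (le_of_lt ht)
          rw [abs_mul, abs_of_nonpos hφ't]
          exact mul_le_mul_of_nonneg_right (hQ t ht.le) (by linarith)
  -- the majorant integral is the limit of the finite ones, each `≤` the bound
  have hlim := intervalIntegral_tendsto_integral_Ioi T₁ hgi tendsto_id
  have hbound : ∫ t in Ioi T₁, (A * Real.log t + B) * (-φ' t) ≤
      (A * Real.log T₁ + B) * φ T₁ + A * ∫ t in Ioi T₁, φ t / t := by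
    refine le_of_tendsto hlim ?_
    filter_upwards [eventually_ge_atTop T₁] with T hT
    exact BPT2021.integral_log_mul_neg_deriv_le h1' hA hB hφ hφ'c hφ0 hint hT
  exact hle.trans hbound

/-- **Brent–Platt–Trudgian 2021, Theorems 1 and 3 — the bound (1.3) for `E₂(T₁) = −∫_{T₁}^∞ φ'Q`,
with the base point free**: for `T₁ ≥ 3`, `A₁ ≥ 0`, `φ ∈ C²[T₁,∞)` with `φ ≥ 0`, `φ' ≤ 0 ≤ φ''`,
`∫_{T₁}^∞ φ/t < ∞`, if `|∫_a^t S| ≤ A₀ + A₁ log t` and `|Q(t) − S(t)| ≤ A₂/t` for `t ≥ T₁`, then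
`|∫_{T₁}^∞ φ'Q| ≤ (|∫_a^{T₁} S| + A₀ + A₁ log T₁)|φ'(T₁)| + (A₁ + A₂)φ(T₁)/T₁`
(the finite Lemma 3, `BrentPlattTrudgian2021_lemma3_E2_base`, and `T₂ → ∞`).
[cite: BrentPlattTrudgian2021, Theorem 1 eq. (1.3) and Theorem 3] -/
theorem BrentPlattTrudgian2021_thm1_E2_base {a T₁ A₀ A₁ A₂ : ℝ} (h1 : 3 ≤ T₁) (hA₁ : 0 ≤ A₁)
    {φ φ' φ'' : ℝ → ℝ}
    (hφ : ∀ t ∈ Ici T₁, HasDerivAt φ (φ' t) t) (hφ' : ∀ t ∈ Ici T₁, HasDerivAt φ' (φ'' t) t)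
    (hφ'' : ContinuousOn φ'' (Ici T₁)) (hφ0 : ∀ t ∈ Ici T₁, 0 ≤ φ t)
    (hφ'0 : ∀ t ∈ Ici T₁, φ' t ≤ 0) (hφ''0 : ∀ t ∈ Ici T₁, 0 ≤ φ'' t)
    (hint : IntegrableOn (fun t ↦ φ t / t) (Ioi T₁))
    (hS1 : ∀ t ∈ Ici T₁, |∫ x in a..t, zetaArgS x| ≤ A₀ + A₁ * Real.log t)
    (hQS : ∀ t ∈ Ici T₁, |((zetaZeroCount t : ℝ) - countMain t) - zetaArgS t| ≤ A₂ / t) :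
    |∫ t in Ioi T₁, ((zetaZeroCount t : ℝ) - countMain t) * φ' t| ≤
      (|∫ x in a..T₁, zetaArgS x| + (A₀ + A₁ * Real.log T₁)) * |φ' T₁| + (A₁ + A₂) * φ T₁ / T₁ := by
  have hT0 : 0 < T₁ := by linarith
  have hφ'c : ContinuousOn φ' (Ici T₁) := fun t ht ↦ (hφ' t ht).continuousAt.continuousWithinAt
  have hQi := BPT2021.integrableOn_count_sub_countMain_mul_deriv h1 hφ hφ'c hφ0 hφ'0 hint
  have hlim := intervalIntegral_tendsto_integral_Ioi T₁ hQi tendsto_id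
  have hlim' := (continuous_abs.tendsto _).comp hlim
  refine le_of_tendsto hlim' ?_
  filter_upwards [eventually_ge_atTop T₁] with T₂ h12
  exact BrentPlattTrudgian2021_lemma3_E2_base hT0 h12 hA₁ (fun t ht ↦ hφ t ht.1)
    (fun t ht ↦ hφ' t ht.1) (hφ''.mono Icc_subset_Ici_self) (fun t ht ↦ hφ'0 t ht.1)
    (fun t ht ↦ hφ''0 t ht.1) (hφ0 T₂ h12) (fun t ht ↦ hS1 t ht.1) (fun t ht ↦ hQS t ht.1)

/-- **Brent–Platt–Trudgian 2021, Theorem 1, eq. (1.3)** (as printed, factor `2`):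
`|E₂(T₁)| ≤ 2(A₀ + A₁ log T₁)|φ'(T₁)| + (A₁ + A₂)φ(T₁)/T₁`.
[cite: BrentPlattTrudgian2021, Theorem 1 eq. (1.3)] -/
theorem BrentPlattTrudgian2021_thm1_E2 {a T₁ A₀ A₁ A₂ : ℝ} (h1 : 3 ≤ T₁) (hA₁ : 0 ≤ A₁)
    {φ φ' φ'' : ℝ → ℝ}
    (hφ : ∀ t ∈ Ici T₁, HasDerivAt φ (φ' t) t) (hφ' : ∀ t ∈ Ici T₁, HasDerivAt φ' (φ'' t) t)
    (hφ'' : ContinuousOn φ'' (Ici T₁)) (hφ0 : ∀ t ∈ Ici T₁, 0 ≤ φ t)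
    (hφ'0 : ∀ t ∈ Ici T₁, φ' t ≤ 0) (hφ''0 : ∀ t ∈ Ici T₁, 0 ≤ φ'' t)
    (hint : IntegrableOn (fun t ↦ φ t / t) (Ioi T₁))
    (hS1 : ∀ t ∈ Ici T₁, |∫ x in a..t, zetaArgS x| ≤ A₀ + A₁ * Real.log t)
    (hQS : ∀ t ∈ Ici T₁, |((zetaZeroCount t : ℝ) - countMain t) - zetaArgS t| ≤ A₂ / t) :
    |∫ t in Ioi T₁, ((zetaZeroCount t : ℝ) - countMain t) * φ' t| ≤
      2 * (A₀ + A₁ * Real.log T₁) * |φ' T₁| + (A₁ + A₂) * φ T₁ / T₁ := by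
  have h := BrentPlattTrudgian2021_thm1_E2_base h1 hA₁ hφ hφ' hφ'' hφ0 hφ'0 hφ''0 hint hS1 hQS
  have hF1 : |∫ x in a..T₁, zetaArgS x| ≤ A₀ + A₁ * Real.log T₁ := hS1 T₁ Set.self_mem_Ici
  have h2 : (|∫ x in a..T₁, zetaArgS x| + (A₀ + A₁ * Real.log T₁)) * |φ' T₁| ≤
      2 * (A₀ + A₁ * Real.log T₁) * |φ' T₁| := by
    apply mul_le_mul_of_nonneg_right _ (abs_nonneg _)
    linarith
  linarith

/-! ## Theorem 1: convergent sums -/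

/-- If `∫_{T₁}^∞ φ(t) log(t/2π) dt < ∞` (`T₁ > 0`, `φ ≥ 0` continuous on `[T₁,∞)`) then
`∫_{T₁}^∞ φ(t)/t dt < ∞` (`1/t ≤ log(t/2π)` for `t ≥ 18`). [cite: BrentPlattTrudgian2021, §4 (first sentence)] -/
theorem BPT2021.integrableOn_div_of_integrableOn_mul_log {T₁ : ℝ} (h1 : 0 < T₁) {φ : ℝ → ℝ}
    (hφc : ContinuousOn φ (Ici T₁)) (hφ0 : ∀ t ∈ Ici T₁, 0 ≤ φ t)
    (hlog : IntegrableOn (fun t ↦ φ t * Real.log (t / (2 * π))) (Ioi T₁)) :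
    IntegrableOn (fun t ↦ φ t / t) (Ioi T₁) := by
  have hπ : π < 3.15 := Real.pi_lt_d2
  set c : ℝ := max T₁ 18 with hc
  have hTc : T₁ ≤ c := le_max_left _ _
  have h18 : (18 : ℝ) ≤ c := le_max_right _ _
  have hunion : Ioi T₁ = Ioc T₁ c ∪ Ioi c := (Ioc_union_Ioi_eq_Ioi hTc).symm
  rw [hunion]
  refine IntegrableOn.union ?_ ?_
  · -- bounded part: continuity
    have hcont : ContinuousOn (fun t ↦ φ t / t) (Icc T₁ c) :=
      (hφc.mono Icc_subset_Ici_self).div continuousOn_id fun t ht ↦ (h1.trans_le ht.1).ne'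
    exact (hcont.integrableOn_Icc (μ := volume)).mono_set Ioc_subset_Icc_self
  · -- tail: `φ/t ≤ φ log(t/2π)`
    have hlog' := hlog.mono_set (Ioi_subset_Ioi hTc)
    refine hlog'.mono' ?_ ?_
    · refine ContinuousOn.aestronglyMeasurable (fun t ht ↦ ?_) measurableSet_Ioi
      have ht : c < t := ht
      exact ((hφc t (show t ∈ Ici T₁ by simp only [mem_Ici]; linarith)).div
        continuousWithinAt_id (by simp only [id]; linarith)).mono
          (fun u hu ↦ by
            have hu' : c < u := hu
            simp only [mem_Ici]
            linarith)
    · refine (ae_restrict_iff' measurableSet_Ioi).2 (Eventually.of_forall fun t ht ↦ ?_)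
      have ht : c < t := ht
      have ht0 : 0 < t := by linarith
      have hφt := hφ0 t (show t ∈ Ici T₁ by simp only [mem_Ici]; linarith)
      have hlog1 : 1 ≤ Real.log (t / (2 * π)) := by
        rw [← Real.log_exp 1]
        refine Real.log_le_log (Real.exp_pos 1) ?_
        rw [le_div_iff₀ (by positivity)]
        have he := Real.exp_one_lt_d9
        have h2π : 2 * π < 6.3 := by linarith
        have : Real.exp 1 * (2 * π) < 2.7182818286 * 6.3 :=
          mul_lt_mul'' he h2π (Real.exp_pos 1).le (by positivity)
        linarith
      rw [Real.norm_eq_abs, abs_of_nonneg (div_nonneg hφt ht0.le), div_eq_mul_inv]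
      refine mul_le_mul_of_nonneg_left ?_ hφt
      calc t⁻¹ ≤ 1 := inv_le_one_of_one_le₀ (by linarith)
        _ ≤ Real.log (t / (2 * π)) := hlog1

/-- **Brent–Platt–Trudgian 2021, Theorem 1** (convergent sums, in the tree's convention): for
`T₁ ≥ 3`, `φ ∈ C¹[T₁,∞)` with `φ ≥ 0`, `φ' ≤ 0` and `∫_{T₁}^∞ φ(t) log(t/2π) dt < ∞`, the sum
`Σ_{T₁<γ} m(ρ)φ(γ)` converges:
`Σ_{T₁<γ≤T₂} m(ρ)φ(γ) → (1/2π)∫_{T₁}^∞ φ log(t/2π) − φ(T₁)Q(T₁) + E₂(T₁)` as `T₂ → ∞`, with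
`E₂(T₁) = −∫_{T₁}^∞ φ'Q` (eqs. (1.1)–(1.2); the bound (1.3) for `E₂` is
`BrentPlattTrudgian2021_thm1_E2`). [cite: BrentPlattTrudgian2021, Theorem 1] -/
theorem BrentPlattTrudgian2021_thm1 {T₁ : ℝ} (h1 : 3 ≤ T₁) {φ φ' : ℝ → ℝ}
    (hφ : ∀ t ∈ Ici T₁, HasDerivAt φ (φ' t) t) (hφ'c : ContinuousOn φ' (Ici T₁))
    (hφ0 : ∀ t ∈ Ici T₁, 0 ≤ φ t) (hφ'0 : ∀ t ∈ Ici T₁, φ' t ≤ 0)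
    (hlog : IntegrableOn (fun t ↦ φ t * Real.log (t / (2 * π))) (Ioi T₁)) :
    Tendsto (fun T₂ ↦ ∑ ρ ∈ zerosBetween T₁ T₂, (riemannZetaZeroOrder ρ : ℝ) * φ ρ.im) atTop
      (𝓝 ((∫ t in Ioi T₁, φ t * Real.log (t / (2 * π))) / (2 * π)
        - φ T₁ * ((zetaZeroCount T₁ : ℝ) - countMain T₁)
        - ∫ t in Ioi T₁, ((zetaZeroCount t : ℝ) - countMain t) * φ' t)) := by
  have hT0 : 0 < T₁ := by linarith
  have hφc : ContinuousOn φ (Ici T₁) := fun t ht ↦ (hφ t ht).continuousAt.continuousWithinAt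
  have hint := BPT2021.integrableOn_div_of_integrableOn_mul_log hT0 hφc hφ0 hlog
  have hmain := BrentPlattTrudgian2021_thm2 h1 hφ hφ'c hφ0 hφ'0 hint
  have hlimL := (intervalIntegral_tendsto_integral_Ioi T₁ hlog tendsto_id).div_const (2 * π)
  have h := hmain.add hlimL
  simp only [id] at h
  have e : -(φ T₁ * ((zetaZeroCount T₁ : ℝ) - countMain T₁))
        - (∫ t in Ioi T₁, ((zetaZeroCount t : ℝ) - countMain t) * φ' t)
        + (∫ t in Ioi T₁, φ t * Real.log (t / (2 * π))) / (2 * π) =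
      (∫ t in Ioi T₁, φ t * Real.log (t / (2 * π))) / (2 * π)
        - φ T₁ * ((zetaZeroCount T₁ : ℝ) - countMain T₁)
        - ∫ t in Ioi T₁, ((zetaZeroCount t : ℝ) - countMain t) * φ' t := by ring
  rw [e] at h
  refine h.congr' ?_
  filter_upwards with T₂
  ring


/-! ## The test function `φ(t) = 1/t` -/

/-- `d/dt (1/t) = −1/t²` on `[T₀, ∞)`, `T₀ > 0` (the test function `φ(t) = 1/t` of the source's §1,
"if `φ(t) = 1/t` and `T₀ = 2π`"). [cite: BrentPlattTrudgian2021, §1 (example φ(t) = 1/t)] -/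
theorem BPT2021.hasDerivAt_one_div {T₀ : ℝ} (h0 : 0 < T₀) :
    ∀ t ∈ Ici T₀, HasDerivAt (fun s : ℝ ↦ 1 / s) (-1 / t ^ 2) t := by
  intro t ht
  have ht0 : 0 < t := h0.trans_le ht
  have h := hasDerivAt_inv ht0.ne'
  have h' := h.congr_of_eventuallyEq (f₁ := fun s : ℝ ↦ 1 / s)
    (Eventually.of_forall fun s ↦ by simp only [one_div])
  refine h'.congr_deriv ?_
  field_simp

/-- `d/dt (−1/t²) = 2/t³` on `[T₀, ∞)`, `T₀ > 0` (`φ'' ≥ 0` for `φ(t) = 1/t`).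
[cite: BrentPlattTrudgian2021, §1 (example φ(t) = 1/t)] -/
theorem BPT2021.hasDerivAt_neg_one_div_sq {T₀ : ℝ} (h0 : 0 < T₀) :
    ∀ t ∈ Ici T₀, HasDerivAt (fun s : ℝ ↦ -1 / s ^ 2) (2 / t ^ 3) t := by
  intro t ht
  have ht0 : 0 < t := h0.trans_le ht
  have h1 : HasDerivAt (fun s : ℝ ↦ s ^ 2) (2 * t) t := by simpa using hasDerivAt_pow 2 t
  have h := (h1.inv (by positivity)).neg
  have h' := h.congr_of_eventuallyEq (f₁ := fun s : ℝ ↦ -1 / s ^ 2)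
    (Eventually.of_forall fun s ↦ by
      show -1 / s ^ 2 = -(s ^ 2)⁻¹
      rw [neg_div, one_div])
  refine h'.congr_deriv ?_
  field_simp

/-- `2/t³` is continuous on `[T₀, ∞)`, `T₀ > 0`. [cite: BrentPlattTrudgian2021, §1 (example φ(t) = 1/t)] -/
theorem BPT2021.continuousOn_two_div_cube {T₀ : ℝ} (h0 : 0 < T₀) :
    ContinuousOn (fun t : ℝ ↦ 2 / t ^ 3) (Ici T₀) :=
  continuousOn_const.div (continuousOn_id.pow 3) fun t ht ↦ by
    have := h0.trans_le ht; positivity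

/-- `−1/t²` is continuous on `[T₀, ∞)`, `T₀ > 0`. [cite: BrentPlattTrudgian2021, §1 (example φ(t) = 1/t)] -/
theorem BPT2021.continuousOn_neg_one_div_sq {T₀ : ℝ} (h0 : 0 < T₀) :
    ContinuousOn (fun t : ℝ ↦ -1 / t ^ 2) (Ici T₀) :=
  continuousOn_const.div (continuousOn_id.pow 2) fun t ht ↦ by
    have := h0.trans_le ht; positivity

/-- `t ↦ (1/t)/t` is integrable on `(T₀, ∞)` for `T₀ > 0` (condition (5.1) for `φ(t) = 1/t`).
[cite: BrentPlattTrudgian2021, §1 (example φ(t) = 1/t) and eq. (5.1)] -/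
theorem BPT2021.integrableOn_one_div_div {T₀ : ℝ} (h0 : 0 < T₀) :
    IntegrableOn (fun t : ℝ ↦ 1 / t / t) (Ioi T₀) := by
  have h := integrableOn_Ioi_rpow_of_lt (by norm_num : (-2 : ℝ) < -1) h0
  refine h.congr_fun (fun t ht ↦ ?_) measurableSet_Ioi
  have ht0 : 0 < t := h0.trans ht
  show t ^ (-2 : ℝ) = 1 / t / t
  rw [Real.rpow_neg ht0.le, show (2 : ℝ) = (2 : ℕ) by norm_num, Real.rpow_natCast]
  field_simp

/-- `∫_{T}^∞ (1/t)/t dt = 1/T` for `T > 0`. [cite: BrentPlattTrudgian2021, §1 (example φ(t) = 1/t)] -/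
theorem BPT2021.integral_Ioi_one_div_div {T : ℝ} (hT : 0 < T) :
    ∫ t in Ioi T, (1 : ℝ) / t / t = 1 / T := by
  have h := integral_Ioi_rpow_of_lt (by norm_num : (-2 : ℝ) < -1) hT
  have e : ∫ t in Ioi T, (1 : ℝ) / t / t = ∫ t in Ioi T, t ^ (-2 : ℝ) := by
    refine setIntegral_congr_fun measurableSet_Ioi fun t ht ↦ ?_
    have ht0 : 0 < t := hT.trans ht
    rw [Real.rpow_neg ht0.le, show (2 : ℝ) = (2 : ℕ) by norm_num, Real.rpow_natCast]
    field_simp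
  rw [e, h, show (-2 : ℝ) + 1 = -1 by norm_num, Real.rpow_neg_one]
  field_simp

end Literature.NumberTheory.LFunctions
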